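import Summits.ABC.StewartYu.PadicG3TwoFunctions
import HarnessLib

/-!
# Cell abc-stewartyu, Gen-3 frame at `p = 2` (crux `Y07Two`, stmt-ABC-19659), layer F2-SLAB: the auxiliary
# functions RELATIVE TO A BASE UNKNOWN on a slab class (design of record D-F2: Yu's supernormality device)

`Summits/ABC/StewartYu/PadicG3TwoSlabFunctions.lean` — cell `abc-stewartyu` (HOME `run/shared/lean/pub/abc-stewartyu/`),
route `PadicPrimesKummerThird`, seat p3 (g5), F-two LEAD.  Definitions and theorems on the M2 datum `TwoSetup`;
sequel to `PadicG3TwoFunctions.lean` (the slab-less case `m = 0`).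

DESIGN OF RECORD D-F2 (planner g8 / p2-g4 K-M3.1 verdict, 2026-08-26): the Schwarz gain `log 4` per zero of the
slab-less k-step forces `(c·n)ⁿ`; Yu's cure (1999/2013, θ-supernormality) restricts the unknowns to ONE class
of the exponents modulo `2^{m+3}` (`m ≈ 8(n+1)/log 2`), so that the exponents DIFFER from a base unknown `i₀`
by `δᵢ = zexpo(i) − zexpo(i₀)` with `‖δᵢ‖ ≤ 2^{−(m+3)}`.  Then

  `f_τ(z) = exp(zexpo(i₀)·z) · G_τ(z)`,  `G_τ(z) = ∑ pᵢ · (Hasse_{t₀} Rᵢ)(z) · ∏ zγⱼ(i)^{tⱼ} · exp(δᵢ·z)`,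

`G_τ` is analytic on the LARGE disc `‖z‖ < 4·2^m` (`analyticAt`/`hasDerivAt` below), `‖G_τ(x)‖ = ‖f_τ(x)‖` at
every integer node (`norm_g3G_intCast`), and the differential equations close up on the same family:
`d/dz G_τ = (t₀+1)·G_{τ+e₀} + ∑ⱼ lg j·G_{τ+eⱼ} − zexpo(i₀)·G_τ` (`hasDerivAt_g3G`; all coefficients of norm
`≤ 1`), so the iterated derivatives of `G_τ` at a point are bounded by the values of the family there
(`norm_iteratedDeriv_g3G_le_of_forall`).  The sequel files run the power series (radius `4·2^m`) and the
Schwarz step (gain `(4·2^m)^{#zeros}` = `(m+2)·log 2` per zero, θ₀(2) = 2) on `G_τ`.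

WHAT THIS IS NOT: no choice of the slab class (p2-g4's `PadicG3Slab` pattern / the record's `m`); no crux moves.

References: K. Yu, Acta Arith. 89 (1999) §2 (supernormality); K. Yu, Acta Math. 211 (2013), (4.7)–(4.11),
Lemma 5.2; Yu 1990 §1.1 (`p = 2`).
-/

noncomputable section

open NormedSpace Finset IsUltrametricDist Polynomial Metric
open Literature.NumberTheory.Transcendental
open Literature.NumberTheory.Transcendental.Baker1975 (bump bump_apply sum_bump)
open Literature.NumberTheory.Transcendental.CW77.Setup (Tau tauNorm bump0 bumpj bumpτ tauNorm_bumpτ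
  bumpτ_zero bumpτ_succ)
open scoped Nat Topology

namespace Summit.ABC.StewartYu

namespace TwoSetup

variable (S : TwoSetup) {ι : Type*} (R : ι → ℚ[X]) (u : ι → Fin S.d → ℤ) (uθ : ι → ℤ)

/-! ### The exponential on the large disc -/

/-- `‖c·z‖ < 2⁻¹` for `‖c‖ ≤ 2^{−(m+3)}`, `‖z‖ < 4·2^m`. [folklore] -/
theorem norm_mul_lt_half_slab {m : ℕ} {c z : ℚ_[2]} (hc : ‖c‖ ≤ ((2 : ℝ) ^ (m + 3))⁻¹)
    (hz : ‖z‖ < 4 * (2 : ℝ) ^ m) : ‖c * z‖ < ((2 : ℕ) : ℝ)⁻¹ := by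
  rw [norm_mul]
  have h2 : (0 : ℝ) < ((2 : ℝ) ^ (m + 3))⁻¹ := by positivity
  calc ‖c‖ * ‖z‖ ≤ ((2 : ℝ) ^ (m + 3))⁻¹ * ‖z‖ := mul_le_mul_of_nonneg_right hc (norm_nonneg _)
    _ < ((2 : ℝ) ^ (m + 3))⁻¹ * (4 * (2 : ℝ) ^ m) := mul_lt_mul_of_pos_left hz h2
    _ = ((2 : ℕ) : ℝ)⁻¹ := by rw [pow_add]; field_simp; norm_num

/-- `d/dz exp(c z) = c exp(c z)` whenever `‖c z‖ < 2⁻¹`. [cite: Koblitz1984, Ch. IV §2] -/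
theorem hasDerivAt_exp_mul_of_lt {c z : ℚ_[2]} (hcz : ‖c * z‖ < ((2 : ℕ) : ℝ)⁻¹) :
    HasDerivAt (fun x : ℚ_[2] => exp (c * x)) (c * exp (c * z)) z := by
  have hmem : z • c ∈ eball (0 : ℚ_[2]) (expSeries ℚ_[2] ℚ_[2]).radius :=
    PadicExp.mem_eball (ℓ := 2) (by rw [smul_eq_mul, mul_comm]; exact hcz)
  have hd := hasDerivAt_exp_smul_const_of_mem_ball' (𝕂 := ℚ_[2]) c z hmem
  have e1 : (fun w : ℚ_[2] => exp (w • c)) = fun w : ℚ_[2] => exp (c * w) := by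
    funext w; rw [smul_eq_mul, mul_comm]
  rw [e1, smul_eq_mul, mul_comm z c] at hd
  exact hd

/-- `z ↦ exp(c z)` is analytic at `z` whenever `‖c z‖ < 2⁻¹`. [cite: Koblitz1984, Ch. IV §2] -/
theorem analyticAt_exp_mul_of_lt {c z : ℚ_[2]} (hcz : ‖c * z‖ < ((2 : ℕ) : ℝ)⁻¹) :
    AnalyticAt ℚ_[2] (fun x : ℚ_[2] => exp (c * x)) z := by
  have h1 : AnalyticAt ℚ_[2] (exp : ℚ_[2] → ℚ_[2]) (c * z) := by
    refine analyticAt_exp_of_mem_ball (c * z) ?_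
    have := PadicExp.mem_eball (ℓ := 2) (E := ℚ_[2]) (a := c * z) hcz
    simpa [smul_eq_mul] using this
  have h2 : AnalyticAt ℚ_[2] (fun x : ℚ_[2] => c * x) z := by fun_prop
  exact h1.comp h2

/-! ### The exponent differences on the slab -/

/-- The exponent DIFFERENCE to the base unknown: `δ(i₀, i) = zexpo(i) − zexpo(i₀)`. [cite: Yu2013, (4.11)] -/
def δexpo (i₀ i : ι) : ℚ_[2] := S.zexpo (u i) (uθ i) - S.zexpo (u i₀) (uθ i₀)

/-- `δ(i₀, i) = ∑ⱼ (zγⱼ(i) − zγⱼ(i₀))·lg j`. [folklore] -/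
theorem δexpo_eq_sum (i₀ i : ι) :
    S.δexpo u uθ i₀ i = ∑ j, ((S.zγ (u i) (uθ i) j : ℚ_[2]) - (S.zγ (u i₀) (uθ i₀) j : ℚ_[2])) * S.lg j := by
  unfold δexpo zexpo
  rw [← Finset.sum_sub_distrib]
  exact Finset.sum_congr rfl fun j _ => by ring

/-- `zexpo(i) = zexpo(i₀) + δ(i₀, i)`. [folklore] -/
theorem zexpo_eq_add_δexpo (i₀ i : ι) :
    S.zexpo (u i) (uθ i) = S.zexpo (u i₀) (uθ i₀) + S.δexpo u uθ i₀ i := by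
  unfold δexpo; ring

/-! ### The functions `G_τ` -/

/-- One term of `G_τ`: `(Hasse_{t₀} Rᵢ)(z) · ∏ zγⱼ^{tⱼ} · exp(δᵢ·z)`. [cite: Yu2013, (4.11), (5.9)] -/
def g3termG (i₀ i : ι) (τ : Tau S.d) (z : ℚ_[2]) : ℚ_[2] :=
  (hw R i τ.1).eval z * (S.zγpow u uθ i τ.2 : ℚ_[2]) * exp (S.δexpo u uθ i₀ i * z)

/-- **`G_τ(z) = ∑_{i∈B} pᵢ · g3termG`** (the slab family relative to `i₀`). [cite: Yu2013, (4.11), (5.9)] -/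
def g3G (B : Finset ι) (p : ι → ℤ) (i₀ : ι) (τ : Tau S.d) (z : ℚ_[2]) : ℚ_[2] :=
  ∑ i ∈ B, (p i : ℚ_[2]) * S.g3termG R u uθ i₀ i τ z

/-- **`f_τ = exp(zexpo(i₀)·z)·G_τ` on `‖z‖ < 4`** (where both exponentials converge). [folklore] -/
theorem g3F_eq_exp_mul_g3G (B : Finset ι) (p : ι → ℤ) (i₀ : ι) {m : ℕ}
    (hslab : ∀ i ∈ B, ‖S.δexpo u uθ i₀ i‖ ≤ ((2 : ℝ) ^ (m + 3))⁻¹) (τ : Tau S.d) {z : ℚ_[2]}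
    (hz : ‖z‖ < 4) :
    S.g3F R u uθ B p τ z = exp (S.zexpo (u i₀) (uθ i₀) * z) * S.g3G R u uθ B p i₀ τ z := by
  unfold g3F g3G
  rw [Finset.mul_sum]
  refine Finset.sum_congr rfl fun i hi => ?_
  unfold g3termF g3termG
  have h0 : ‖S.zexpo (u i₀) (uθ i₀) * z‖ < ((2 : ℕ) : ℝ)⁻¹ := norm_mul_lt_half (S.norm_zexpo_le _ _) hz
  have hzm : ‖z‖ < 4 * (2 : ℝ) ^ m := by
    have : (1 : ℝ) ≤ 2 ^ m := one_le_pow₀ (by norm_num)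
    nlinarith
  have h1 : ‖S.δexpo u uθ i₀ i * z‖ < ((2 : ℕ) : ℝ)⁻¹ := norm_mul_lt_half_slab (hslab i hi) hzm
  rw [S.zexpo_eq_add_δexpo u uθ i₀ i, add_mul, PadicExp.exp_add (ℓ := 2) h0 h1]
  ring

/-- **At every integer node `‖G_τ(x)‖ = ‖f_τ(x)‖`** (the prefactor `exp(zexpo(i₀)·x)` is a unit). [folklore] -/
theorem norm_g3G_intCast (B : Finset ι) (p : ι → ℤ) (i₀ : ι) {m : ℕ}
    (hslab : ∀ i ∈ B, ‖S.δexpo u uθ i₀ i‖ ≤ ((2 : ℝ) ^ (m + 3))⁻¹) (τ : Tau S.d) (x : ℤ) :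
    ‖S.g3G R u uθ B p i₀ τ (x : ℚ_[2])‖ = ‖S.g3F R u uθ B p τ (x : ℚ_[2])‖ := by
  have hx : ‖(x : ℚ_[2])‖ < 4 := lt_of_le_of_lt (Padic.norm_int_le_one _) (by norm_num)
  rw [S.g3F_eq_exp_mul_g3G R u uθ B p i₀ hslab τ hx, norm_mul, mul_comm (S.zexpo _ _) _,
    S.norm_exp_intCast_mul_zexpo, one_mul]

/-! ### The differential equations of the slab family -/

/-- **The derivative of one term**:
`d/dz g3termG_τ = (t₀+1)·g3termG_{τ+e₀} + ∑ⱼ lg j·g3termG_{τ+eⱼ} − zexpo(i₀)·g3termG_τ` on `‖z‖ < 4·2^m`.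
[cite: CijsouwWaldschmidt1977, §4 (p. 188)] -/
theorem hasDerivAt_g3termG (i₀ i : ι) {m : ℕ} (hδ : ‖S.δexpo u uθ i₀ i‖ ≤ ((2 : ℝ) ^ (m + 3))⁻¹)
    (τ : Tau S.d) {z : ℚ_[2]} (hz : ‖z‖ < 4 * (2 : ℝ) ^ m) :
    HasDerivAt (S.g3termG R u uθ i₀ i τ)
      (((τ.1 + 1 : ℕ) : ℚ_[2]) * S.g3termG R u uθ i₀ i (bump0 τ) z +
        ∑ j : Fin S.d, S.lg j * S.g3termG R u uθ i₀ i (bumpj τ j) z -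
        S.zexpo (u i₀) (uθ i₀) * S.g3termG R u uθ i₀ i τ z) z := by
  have hcz : ‖S.δexpo u uθ i₀ i * z‖ < ((2 : ℕ) : ℝ)⁻¹ := norm_mul_lt_half_slab hδ hz
  have h1 : HasDerivAt (fun w => (hw R i τ.1).eval w)
      (((τ.1 + 1 : ℕ) : ℚ_[2]) * (hw R i (τ.1 + 1)).eval z) z := by
    have h := Polynomial.hasDerivAt (hw R i τ.1) z
    rw [eval_derivative_hw R] at h
    exact h
  have h2 : HasDerivAt (fun w => (S.zγpow u uθ i τ.2 : ℚ_[2]) * exp (S.δexpo u uθ i₀ i * w))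
      ((S.zγpow u uθ i τ.2 : ℚ_[2]) * (S.δexpo u uθ i₀ i * exp (S.δexpo u uθ i₀ i * z))) z :=
    (hasDerivAt_exp_mul_of_lt hcz).const_mul _
  have hsplit : S.g3termG R u uθ i₀ i τ =
      fun w => (hw R i τ.1).eval w * ((S.zγpow u uθ i τ.2 : ℚ_[2]) * exp (S.δexpo u uθ i₀ i * w)) := by
    funext w; simp only [g3termG]; ring
  rw [hsplit]
  refine (h1.mul h2).congr_deriv ?_
  have er : ∀ j : Fin S.d, S.lg j * S.g3termG R u uθ i₀ i (bumpj τ j) z =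
      (hw R i τ.1).eval z * ((S.zγpow u uθ i τ.2 : ℚ_[2]) * exp (S.δexpo u uθ i₀ i * z)) *
        ((S.zγ (u i) (uθ i) j : ℚ_[2]) * S.lg j) := by
    intro j
    simp only [g3termG, bumpj]
    rw [S.zγpow_bump_cast]
    ring
  simp_rw [er]
  rw [← mul_sum]
  have hexpo : S.zexpo (u i) (uθ i) = ∑ j, (S.zγ (u i) (uθ i) j : ℚ_[2]) * S.lg j := rfl
  have hδ' : S.δexpo u uθ i₀ i = (∑ j, (S.zγ (u i) (uθ i) j : ℚ_[2]) * S.lg j) - S.zexpo (u i₀) (uθ i₀) := by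
    unfold δexpo; rw [hexpo]
  simp only [g3termG, bump0]
  rw [hδ']
  ring

/-- The coefficients of the slab differential equation: `t₀ + 1` (direction `Y₀`), `lg j` (direction `αⱼ`),
and `−zexpo(i₀)` (the base term), all of norm `≤ 1`. [folklore] -/
theorem norm_zexpo_base_le (i₀ : ι) : ‖S.zexpo (u i₀) (uθ i₀)‖ ≤ 1 :=
  (S.norm_zexpo_le _ _).trans (by norm_num)

/-- **`d/dz G_τ = (t₀+1)·G_{τ+e₀} + ∑ⱼ lg j·G_{τ+eⱼ} − zexpo(i₀)·G_τ`** on `‖z‖ < 4·2^m`.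
[cite: Yu2013, (4.11)] -/
theorem hasDerivAt_g3G (B : Finset ι) (p : ι → ℤ) (i₀ : ι) {m : ℕ}
    (hslab : ∀ i ∈ B, ‖S.δexpo u uθ i₀ i‖ ≤ ((2 : ℝ) ^ (m + 3))⁻¹) (τ : Tau S.d) {z : ℚ_[2]}
    (hz : ‖z‖ < 4 * (2 : ℝ) ^ m) :
    HasDerivAt (S.g3G R u uθ B p i₀ τ)
      (∑ k : Fin (S.d + 1), S.g3coef τ k * S.g3G R u uθ B p i₀ (bumpτ τ k) z -
        S.zexpo (u i₀) (uθ i₀) * S.g3G R u uθ B p i₀ τ z) z := by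
  unfold g3G
  have h := HasDerivAt.fun_sum fun i (hi : i ∈ B) =>
    (S.hasDerivAt_g3termG R u uθ i₀ i (hslab i hi) τ hz).const_mul (p i : ℚ_[2])
  refine h.congr_deriv ?_
  have h0 : S.g3coef τ 0 = ((τ.1 + 1 : ℕ) : ℚ_[2]) := rfl
  have hs : ∀ j : Fin S.d, S.g3coef τ j.succ = S.lg j := fun j => rfl
  simp only [Fin.sum_univ_succ, h0, hs, bumpτ_zero, bumpτ_succ, mul_add, mul_sub, sum_add_distrib,
    sum_sub_distrib, mul_sum]
  congr 1
  · congr 1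
    · exact sum_congr rfl fun i _ => by ring
    · rw [sum_comm]
      exact sum_congr rfl fun j _ => sum_congr rfl fun i _ => by ring
  · exact sum_congr rfl fun i _ => by ring

/-- `G_τ` is smooth at every point of `‖z‖ < 4·2^m`. [folklore] -/
theorem contDiffAt_g3G (B : Finset ι) (p : ι → ℤ) (i₀ : ι) {m : ℕ}
    (hslab : ∀ i ∈ B, ‖S.δexpo u uθ i₀ i‖ ≤ ((2 : ℝ) ^ (m + 3))⁻¹) (τ : Tau S.d) (n : WithTop ℕ∞)
    {z : ℚ_[2]} (hz : ‖z‖ < 4 * (2 : ℝ) ^ m) : ContDiffAt ℚ_[2] n (S.g3G R u uθ B p i₀ τ) z := by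
  unfold g3G g3termG
  refine ContDiffAt.sum fun i hi => contDiffAt_const.mul ?_
  exact ((contDiffAt_hw R i τ.1 n z).mul contDiffAt_const).mul
    (analyticAt_exp_mul_of_lt (norm_mul_lt_half_slab (hslab i hi) hz)).contDiffAt

/-- `deriv G_τ` near every point of `‖z‖ < 4·2^m`. [folklore] -/
theorem deriv_g3G_eventuallyEq (B : Finset ι) (p : ι → ℤ) (i₀ : ι) {m : ℕ}
    (hslab : ∀ i ∈ B, ‖S.δexpo u uθ i₀ i‖ ≤ ((2 : ℝ) ^ (m + 3))⁻¹) (τ : Tau S.d) {a : ℚ_[2]}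
    (ha : ‖a‖ < 4 * (2 : ℝ) ^ m) :
    deriv (S.g3G R u uθ B p i₀ τ) =ᶠ[𝓝 a]
      fun z => ∑ k : Fin (S.d + 1), S.g3coef τ k * S.g3G R u uθ B p i₀ (bumpτ τ k) z -
        S.zexpo (u i₀) (uθ i₀) * S.g3G R u uθ B p i₀ τ z := by
  have hball : {z : ℚ_[2] | ‖z‖ < 4 * (2 : ℝ) ^ m} ∈ 𝓝 a := by
    have : {z : ℚ_[2] | ‖z‖ < 4 * (2 : ℝ) ^ m} = Metric.ball 0 (4 * (2 : ℝ) ^ m) := by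
      ext z; simp
    rw [this]
    exact Metric.isOpen_ball.mem_nhds (by simpa using ha)
  filter_upwards [hball] with z hz using (S.hasDerivAt_g3G R u uθ B p i₀ hslab τ hz).deriv

/-- **The iterated derivatives**: `G_τ^{(k+1)}(a) = ∑ₖ cₖ(τ) G_{τ+eₖ}^{(k)}(a) − zexpo(i₀)·G_τ^{(k)}(a)`.
[cite: CijsouwWaldschmidt1977, §4 (11) (p. 189)] -/
theorem iteratedDeriv_g3G_succ (B : Finset ι) (p : ι → ℤ) (i₀ : ι) {m : ℕ}
    (hslab : ∀ i ∈ B, ‖S.δexpo u uθ i₀ i‖ ≤ ((2 : ℝ) ^ (m + 3))⁻¹) (τ : Tau S.d) {a : ℚ_[2]}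
    (ha : ‖a‖ < 4 * (2 : ℝ) ^ m) (k : ℕ) :
    iteratedDeriv (k + 1) (S.g3G R u uθ B p i₀ τ) a =
      ∑ i : Fin (S.d + 1), S.g3coef τ i * iteratedDeriv k (S.g3G R u uθ B p i₀ (bumpτ τ i)) a -
        S.zexpo (u i₀) (uθ i₀) * iteratedDeriv k (S.g3G R u uθ B p i₀ τ) a := by
  have hsum : ContDiffAt ℚ_[2] k
      (fun z => ∑ i : Fin (S.d + 1), S.g3coef τ i * S.g3G R u uθ B p i₀ (bumpτ τ i) z) a :=
    ContDiffAt.sum fun i _ => contDiffAt_const.mul (S.contDiffAt_g3G R u uθ B p i₀ hslab (bumpτ τ i) k ha)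
  have hbase : ContDiffAt ℚ_[2] k (fun z => S.zexpo (u i₀) (uθ i₀) * S.g3G R u uθ B p i₀ τ z) a :=
    contDiffAt_const.mul (S.contDiffAt_g3G R u uθ B p i₀ hslab τ k ha)
  rw [iteratedDeriv_succ', (S.deriv_g3G_eventuallyEq R u uθ B p i₀ hslab τ ha).iteratedDeriv_eq k,
    iteratedDeriv_fun_sub hsum hbase,
    iteratedDeriv_fun_sum fun i _ =>
      contDiffAt_const.mul (S.contDiffAt_g3G R u uθ B p i₀ hslab (bumpτ τ i) k ha),
    iteratedDeriv_const_mul _ (S.contDiffAt_g3G R u uθ B p i₀ hslab τ k ha)]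
  congr 1
  refine sum_congr rfl fun i _ => ?_
  exact iteratedDeriv_const_mul _ (S.contDiffAt_g3G R u uθ B p i₀ hslab (bumpτ τ i) k ha)

/-- **Derivatives of the slab family are controlled by its values, without loss**: if `‖G_τ'(a)‖ ≤ ε`
whenever `|τ'| ≤ N`, then `‖G_τ^{(k)}(a)‖ ≤ ε` whenever `|τ| + k ≤ N` (`‖a‖ < 4·2^m`; the coefficients
`t₀+1`, `lg j`, `zexpo(i₀)` have norm `≤ 1`). [cite: Yu1990, Lemma 2.4] -/
theorem norm_iteratedDeriv_g3G_le_of_forall (B : Finset ι) (p : ι → ℤ) (i₀ : ι) {m : ℕ}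
    (hslab : ∀ i ∈ B, ‖S.δexpo u uθ i₀ i‖ ≤ ((2 : ℝ) ^ (m + 3))⁻¹) {a : ℚ_[2]}
    (ha : ‖a‖ < 4 * (2 : ℝ) ^ m) (N : ℕ) {ε : ℝ} (hε0 : 0 ≤ ε)
    (hε : ∀ τ : Tau S.d, tauNorm τ ≤ N → ‖S.g3G R u uθ B p i₀ τ a‖ ≤ ε) :
    ∀ (k : ℕ) (τ : Tau S.d), tauNorm τ + k ≤ N →
      ‖iteratedDeriv k (S.g3G R u uθ B p i₀ τ) a‖ ≤ ε := by
  intro k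
  induction k with
  | zero => intro τ hτ; simpa using hε τ (by simpa using hτ)
  | succ k ih =>
    intro τ hτ
    rw [S.iteratedDeriv_g3G_succ R u uθ B p i₀ hslab τ ha k, sub_eq_add_neg]
    refine (norm_add_le_max _ _).trans (max_le ?_ ?_)
    · refine IsUltrametricDist.norm_sum_le_of_forall_le_of_nonneg hε0 fun i _ => ?_
      rw [norm_mul]
      refine (mul_le_of_le_one_left (norm_nonneg _) (S.norm_g3coef_le τ i)).trans (ih _ ?_)
      rw [tauNorm_bumpτ]; omega
    · rw [norm_neg, norm_mul]
      exact (mul_le_of_le_one_left (norm_nonneg _) (S.norm_zexpo_base_le u uθ i₀)).trans (ih τ (by omega))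

end TwoSetup

end Summit.ABC.StewartYu

end
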